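import Mathlib.MeasureTheory.Measure.CharacteristicFunction.Basic
import Mathlib.MeasureTheory.Function.ConditionalExpectation.Unique
import Mathlib.MeasureTheory.Function.StronglyMeasurable.Inner
import Mathlib.Analysis.InnerProductSpace.PiL2
import HarnessLib

/-!
# The characters `e^{i X(v)}` of a linear process are total

Let `X : V →ₗ[ℝ] (Ω → ℝ)` be a *linear* real process on a finite measure space (a random linear
functional: `X (a • u + b • v) = a X u + b X v` pointwise), with every `X v` measurable, and let
`𝒜 = σ(X v : v ∈ V) = ⨆ v, comap (X v)` be the σ-algebra it generates.  If an integrable,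
`𝒜`-measurable `f` satisfies `∫ e^{i X v} f dμ = 0` for every `v ∈ V`, then `f = 0` a.e.
(`ae_eq_zero_of_forall_integral_cexp_mul_eq_zero_real`, complex version
`ae_eq_zero_of_forall_integral_cexp_mul_eq_zero`).  Equivalently: the trigonometric functions
`e^{i X v}` span a weak-* dense (total) subspace of `L^∞(𝒜)` against `L¹(𝒜)`; in particular their
span is dense in `L²(Ω, 𝒜, μ)`.  This is the standard uniqueness step behind "polynomials /
exponentials of a Gaussian family are dense in `L²` of the σ-algebra it generates" (S. Janson,
*Gaussian Hilbert Spaces*, CUP 1997, Thm 2.6 and its proof via characteristic functions;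
D. Nualart, *The Malliavin calculus and related topics*, Lemma 1.1.2).

Proof: for a finite family `v₁,…,vₙ` the signed measure `f dμ` pushed forward by
`Y = (X v₁,…,X vₙ)` has vanishing Fourier transform (`∑ tⱼ X vⱼ = X (∑ tⱼ vⱼ)` by linearity), so
its positive and negative parts have equal characteristic functions and coincide
(`Measure.ext_of_charFun`); hence `∫_A f = 0` on the π-system of finite-dimensional cylinder sets,
hence on `𝒜` (π–λ), hence `f = 0` a.e. (`ae_eq_of_forall_setIntegral_eq_of_sigmaFinite'`).

Mathlib: `charFun`, `Measure.ext_of_charFun`, `piiUnionInter`, `induction_on_inter`; the statement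
was verified absent at the pin (`lean search 'total|charFun.*comap'`).
-/

noncomputable section

open MeasureTheory Complex Set
open scoped ENNReal InnerProductSpace

namespace Literature.Probability.Process

variable {Ω : Type*} {m₀ : MeasurableSpace Ω} {μ : Measure Ω}
variable {V : Type*} [AddCommGroup V] [Module ℝ V]

/-- The σ-algebra generated by a family of real random variables `X v`, `v ∈ V`. [folklore] -/
@[reducible] def generatedSigma (X : V → Ω → ℝ) : MeasurableSpace Ω :=
  ⨆ v, MeasurableSpace.comap (X v) inferInstance

omit [AddCommGroup V] [Module ℝ V] in
/-- Each generator is measurable for the generated σ-algebra. [folklore] -/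
theorem measurable_generatedSigma (X : V → Ω → ℝ) (v : V) :
    Measurable[generatedSigma X] (X v) :=
  measurable_iff_comap_le.2 (le_iSup (fun v => MeasurableSpace.comap (X v) inferInstance) v)

omit [AddCommGroup V] [Module ℝ V] in
/-- The generated σ-algebra is a sub-σ-algebra of the ambient one when the generators are
measurable. [folklore] -/
theorem generatedSigma_le {X : V → Ω → ℝ} (hX : ∀ v, Measurable (X v)) : generatedSigma X ≤ m₀ :=
  iSup_le fun v => (hX v).comap_le

/-! ### Finite-dimensional marginals -/

section Marginal

variable (X : V →ₗ[ℝ] Ω → ℝ) (s : Finset V)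

/-- The finite-dimensional marginal `ω ↦ (X v ω)_{v ∈ s}` with values in the Euclidean space
`ℝ^s`. [folklore] -/
def marginal (ω : Ω) : EuclideanSpace ℝ s := (EuclideanSpace.equiv s ℝ).symm fun i => X i ω

/-- Coordinates of the marginal. [folklore] -/
@[simp] theorem marginal_apply (ω : Ω) (i : s) : marginal X s ω i = X i ω := rfl

/-- The marginal is measurable when the generators are. [folklore] -/
theorem measurable_marginal (hX : ∀ v, Measurable (X v)) : Measurable (marginal X s) :=
  (EuclideanSpace.equiv s ℝ).symm.continuous.measurable.comp
    (measurable_pi_lambda _ fun i => hX i)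

/-- Linearity: `⟪Y ω, t⟫ = X (∑ⱼ tⱼ vⱼ) ω`. [folklore] -/
theorem inner_marginal (ω : Ω) (t : EuclideanSpace ℝ s) :
    ⟪marginal X s ω, t⟫_ℝ = X (∑ i : s, t i • (i : V)) ω := by
  rw [PiLp.inner_apply, map_sum, Finset.sum_apply]
  refine Finset.sum_congr rfl fun i _ => ?_
  rw [map_smul, Pi.smul_apply, smul_eq_mul, marginal_apply, RCLike.inner_apply, conj_trivial]

end Marginal

/-! ### The real case -/

section RealCase

variable [IsFiniteMeasure μ] (X : V →ₗ[ℝ] Ω → ℝ)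

omit [IsFiniteMeasure μ] in
/-- **Cylinder sets carry no mass.** If `∫ e^{i X v} f = 0` for all `v`, then `∫_{Y⁻¹ C} f = 0` for
every finite-dimensional marginal `Y = (X v)_{v ∈ s}` and measurable `C ⊆ ℝ^s`: the finite measures
`(f⁺μ) ∘ Y⁻¹` and `(f⁻μ) ∘ Y⁻¹` have the same characteristic function. [folklore] -/
theorem setIntegral_preimage_marginal_eq_zero (hX : ∀ v, Measurable (X v)) {f : Ω → ℝ}
    (hf : Integrable f μ)
    (h : ∀ v, ∫ ω, cexp (X v ω * I) * (f ω : ℂ) ∂μ = 0) (s : Finset V)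
    {C : Set (EuclideanSpace ℝ s)} (hC : MeasurableSet C) :
    ∫ ω in marginal X s ⁻¹' C, f ω ∂μ = 0 := by
  have hY := measurable_marginal X s hX
  set ν₁ : Measure (EuclideanSpace ℝ s) :=
    (μ.withDensity fun ω => ENNReal.ofReal (f ω)).map (marginal X s) with hν₁
  set ν₂ : Measure (EuclideanSpace ℝ s) :=
    (μ.withDensity fun ω => ENNReal.ofReal (-f ω)).map (marginal X s) with hν₂
  haveI : IsFiniteMeasure (μ.withDensity fun ω => ENNReal.ofReal (f ω)) :=
    isFiniteMeasure_withDensity_ofReal hf.2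
  haveI : IsFiniteMeasure (μ.withDensity fun ω => ENNReal.ofReal (-f ω)) :=
    isFiniteMeasure_withDensity_ofReal hf.neg.2
  haveI : IsFiniteMeasure ν₁ := Measure.isFiniteMeasure_map _ _
  haveI : IsFiniteMeasure ν₂ := Measure.isFiniteMeasure_map _ _
  -- characteristic functions as `μ`-integrals
  have hchar : ∀ (g : Ω → ℝ), Integrable g μ → ∀ t : EuclideanSpace ℝ s,
      charFun ((μ.withDensity fun ω => ENNReal.ofReal (g ω)).map (marginal X s)) t =
        ∫ ω, ((max (g ω) 0 : ℝ) : ℂ) * cexp (X (∑ i : s, t i • (i : V)) ω * I) ∂μ := by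
    intro g hg t
    rw [charFun_apply, integral_map hY.aemeasurable (by fun_prop),
      integral_withDensity_eq_integral_toReal_smul₀ (by fun_prop)
        (ae_of_all _ fun _ => ENNReal.ofReal_lt_top)]
    refine integral_congr_ae (ae_of_all _ fun ω => ?_)
    simp only []
    rw [ENNReal.toReal_ofReal', Complex.real_smul, inner_marginal]
  -- the exponential factor is bounded by one
  have hexp : ∀ t : EuclideanSpace ℝ s,
      AEStronglyMeasurable (fun ω => cexp (X (∑ i : s, t i • (i : V)) ω * I)) μ ∧
        ∀ᵐ ω ∂μ, ‖cexp (X (∑ i : s, t i • (i : V)) ω * I)‖ ≤ 1 := fun t =>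
    ⟨by fun_prop, ae_of_all _ fun ω => by rw [Complex.norm_exp_ofReal_mul_I]⟩
  have hνeq : ν₁ = ν₂ := by
    refine Measure.ext_of_charFun (funext fun t => ?_)
    have hi1 : Integrable (fun ω => ((max (f ω) 0 : ℝ) : ℂ) *
        cexp (X (∑ i : s, t i • (i : V)) ω * I)) μ :=
      (hf.pos_part.ofReal).mul_bdd (hexp t).1 (hexp t).2
    have hi2 : Integrable (fun ω => ((max (-f ω) 0 : ℝ) : ℂ) *
        cexp (X (∑ i : s, t i • (i : V)) ω * I)) μ :=
      (hf.neg.pos_part.ofReal).mul_bdd (hexp t).1 (hexp t).2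
    rw [hν₁, hν₂, hchar f hf t, hchar (fun ω => -f ω) hf.neg t, ← sub_eq_zero,
      ← integral_sub hi1 hi2]
    rw [← h (∑ i : s, t i • (i : V))]
    refine integral_congr_ae (ae_of_all _ fun ω => ?_)
    simp only []
    rw [← sub_mul, ← Complex.ofReal_sub, max_zero_sub_max_neg_zero_eq_self, mul_comm]
  -- equality of the two push-forwards on `C` gives `∫_{Y⁻¹ C} f⁺ = ∫_{Y⁻¹ C} f⁻`
  have hpre : MeasurableSet (marginal X s ⁻¹' C) := hY hC
  have h₁ : ν₁ C = ∫⁻ ω in marginal X s ⁻¹' C, ENNReal.ofReal (f ω) ∂μ := by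
    rw [hν₁, Measure.map_apply hY hC, withDensity_apply _ hpre]
  have h₂ : ν₂ C = ∫⁻ ω in marginal X s ⁻¹' C, ENNReal.ofReal (-f ω) ∂μ := by
    rw [hν₂, Measure.map_apply hY hC, withDensity_apply _ hpre]
  rw [integral_eq_lintegral_pos_part_sub_lintegral_neg_part hf.integrableOn, ← h₁, ← h₂, hνeq,
    sub_self]

/-- **Totality of the characters, real form.** For a linear real process `X` with measurable
values on a finite measure space: an integrable `f`, measurable for `σ(X v : v ∈ V)`, with
`∫ e^{i X v} f dμ = 0` for every `v`, vanishes a.e. (Janson 1997, proof of Thm 2.6; Nualart,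
Lemma 1.1.2).  Proof: `∫_A f = 0` on cylinder sets (`setIntegral_preimage_marginal_eq_zero`),
π–λ to `σ(X)`, then uniqueness. [cite: Janson1997, Thm 2.6 (proof)] -/
theorem ae_eq_zero_of_forall_integral_cexp_mul_eq_zero_real (hX : ∀ v, Measurable (X v))
    {f : Ω → ℝ} (hf : Integrable f μ) (hfm : AEStronglyMeasurable[generatedSigma X] f μ)
    (h : ∀ v, ∫ ω, cexp (X v ω * I) * (f ω : ℂ) ∂μ = 0) : f =ᵐ[μ] 0 := by
  have hle : generatedSigma X ≤ m₀ := generatedSigma_le hX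
  haveI : SigmaFinite (μ.trim hle) := by
    haveI : IsFiniteMeasure (μ.trim hle) := isFiniteMeasure_trim hle
    infer_instance
  -- `∫_A f = 0` for every `A ∈ σ(X)`, by π–λ from the cylinder sets
  have hzero : ∀ A, MeasurableSet[generatedSigma X] A → ∫ ω in A, f ω ∂μ = 0 := by
    have hgen : generatedSigma (X : V → Ω → ℝ) = MeasurableSpace.generateFrom
        (piiUnionInter (fun v => {A | MeasurableSet[MeasurableSpace.comap (X v) inferInstance] A})
          Set.univ) := by
      have hpi := generateFrom_piiUnionInter_measurableSet
        (fun v => MeasurableSpace.comap (X v) (inferInstance : MeasurableSpace ℝ)) Set.univ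
      simp only [iSup_univ] at hpi
      exact hpi.symm
    refine MeasurableSpace.induction_on_inter hgen (isPiSystem_piiUnionInter _
      (fun v => @MeasurableSpace.isPiSystem_measurableSet Ω
        (MeasurableSpace.comap (X v) inferInstance)) _) (by simp) ?_ ?_ ?_
    · -- cylinder sets
      rintro A ⟨s, -, g, hg, rfl⟩
      classical
      have hg' : ∀ v ∈ s, ∃ B : Set ℝ, MeasurableSet B ∧ X v ⁻¹' B = g v := fun v hv =>
        MeasurableSpace.measurableSet_comap.1 (hg v hv)
      choose! B hBm hBeq using hg'
      set C : Set (EuclideanSpace ℝ s) := {x | ∀ i : s, x i ∈ B i} with hCdef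
      have hC : MeasurableSet C := by
        have : C = ⋂ i : s, (fun x : EuclideanSpace ℝ s => x i) ⁻¹' B i := by
          ext x; simp [hCdef]
        rw [this]
        exact MeasurableSet.iInter fun i =>
          (EuclideanSpace.proj i).continuous.measurable (hBm i i.2)
      have hA : (⋂ v ∈ s, g v) = marginal X s ⁻¹' C := by
        ext ω
        simp only [Set.mem_iInter, Set.mem_preimage, hCdef, Set.mem_setOf_eq, marginal_apply,
          Subtype.forall]
        refine forall₂_congr fun v hv => ?_
        rw [← hBeq v hv, Set.mem_preimage]
      rw [hA]
      exact setIntegral_preimage_marginal_eq_zero X hX hf h s hC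
    · -- complements
      intro A hA hA0
      have hAm : MeasurableSet A := hle A hA
      have huniv : ∫ ω, f ω ∂μ = 0 := by
        have h0 := h 0
        simp only [map_zero, Pi.zero_apply, Complex.ofReal_zero, zero_mul, Complex.exp_zero,
          one_mul] at h0
        rw [integral_complex_ofReal] at h0
        exact_mod_cast h0
      rw [← integral_add_compl hAm hf, hA0, zero_add] at huniv
      exact huniv
    · -- countable disjoint unions
      intro g hdisj hgm hg0
      rw [integral_iUnion (fun i => hle _ (hgm i)) hdisj hf.integrableOn]
      simp [hg0]
  -- uniqueness
  refine ae_eq_of_forall_setIntegral_eq_of_sigmaFinite' hle (fun A _ _ => hf.integrableOn)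
    (fun A _ _ => integrableOn_zero) (fun A hA _ => ?_) hfm aestronglyMeasurable_zero
  rw [hzero A hA]
  simp

end RealCase

/-! ### The complex case -/

section ComplexCase

variable [IsFiniteMeasure μ] (X : V →ₗ[ℝ] Ω → ℝ)

/-- **Totality of the characters `e^{i X v}`, complex form.** For a linear real process `X` with
measurable values on a finite measure space: an integrable complex `h`, measurable for
`σ(X v : v ∈ V)`, with `∫ e^{i X v} h dμ = 0` for every `v ∈ V`, vanishes a.e.  Hence the span
of `{e^{i X v}}` is dense in `L²(Ω, σ(X), μ)` (take `h` orthogonal to it).  Reduction to the real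
case: `∫ e^{iXv} conj h = conj ∫ e^{-iXv} h = 0` (`-v ∈ V`), so the real and imaginary parts of
`h` satisfy the real hypothesis. [cite: Janson1997, Thm 2.6 (proof)] -/
theorem ae_eq_zero_of_forall_integral_cexp_mul_eq_zero (hX : ∀ v, Measurable (X v))
    {h : Ω → ℂ} (hh : Integrable h μ) (hhm : AEStronglyMeasurable[generatedSigma X] h μ)
    (horth : ∀ v, ∫ ω, cexp (X v ω * I) * h ω ∂μ = 0) : h =ᵐ[μ] 0 := by
  -- the conjugate hypothesis
  have hconj : ∀ v, ∫ ω, cexp (X v ω * I) * (starRingEnd ℂ) (h ω) ∂μ = 0 := fun v => by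
    have h1 := horth (-v)
    have h2 : ∫ ω, cexp (X v ω * I) * (starRingEnd ℂ) (h ω) ∂μ =
        (starRingEnd ℂ) (∫ ω, cexp (X (-v) ω * I) * h ω ∂μ) := by
      rw [← integral_conj]
      refine integral_congr_ae (ae_of_all _ fun ω => ?_)
      simp only [map_mul, map_neg, Pi.neg_apply, Complex.ofReal_neg, neg_mul, ← Complex.exp_conj,
        Complex.conj_ofReal, Complex.conj_I, mul_neg, neg_neg]
    rw [h2, h1, map_zero]
  have hbdd : ∀ v, AEStronglyMeasurable (fun ω => cexp (X v ω * I)) μ ∧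
      ∀ᵐ ω ∂μ, ‖cexp (X v ω * I)‖ ≤ 1 := fun v =>
    ⟨by fun_prop, ae_of_all _ fun ω => by rw [Complex.norm_exp_ofReal_mul_I]⟩
  -- real and imaginary parts: `2 re h = h + conj h`, `2i im h = h - conj h`
  have hparts : ∀ v, ∫ ω, cexp (X v ω * I) * ((h ω).re : ℂ) ∂μ = 0 ∧
      ∫ ω, cexp (X v ω * I) * ((h ω).im : ℂ) ∂μ = 0 := by
    intro v
    have hih : Integrable (fun ω => cexp (X v ω * I) * h ω) μ := hh.bdd_mul (hbdd v).1 (hbdd v).2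
    have hcc : Integrable (fun ω => (starRingEnd ℂ) (h ω)) μ :=
      (ContinuousLinearEquiv.integrable_comp_iff Complex.conjCLE).2 hh
    have hic : Integrable (fun ω => cexp (X v ω * I) * (starRingEnd ℂ) (h ω)) μ :=
      hcc.bdd_mul (hbdd v).1 (hbdd v).2
    constructor
    · have : (fun ω => cexp (X v ω * I) * ((h ω).re : ℂ)) = fun ω =>
          (1 / 2 : ℂ) * (cexp (X v ω * I) * h ω + cexp (X v ω * I) * (starRingEnd ℂ) (h ω)) := by
        funext ω; rw [Complex.re_eq_add_conj]; ring
      rw [this, integral_const_mul, integral_add hih hic, horth v, hconj v]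
      simp
    · have : (fun ω => cexp (X v ω * I) * ((h ω).im : ℂ)) = fun ω =>
          (1 / (2 * I) : ℂ) * (cexp (X v ω * I) * h ω - cexp (X v ω * I) * (starRingEnd ℂ) (h ω)) := by
        funext ω; rw [Complex.im_eq_sub_conj]; ring
      rw [this, integral_const_mul, integral_sub hih hic, horth v, hconj v]
      simp
  have hre : (fun ω => (h ω).re) =ᵐ[μ] 0 :=
    ae_eq_zero_of_forall_integral_cexp_mul_eq_zero_real X hX hh.re
      (AEStronglyMeasurable.re hhm) fun v => (hparts v).1
  have him : (fun ω => (h ω).im) =ᵐ[μ] 0 :=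
    ae_eq_zero_of_forall_integral_cexp_mul_eq_zero_real X hX hh.im
      (AEStronglyMeasurable.im hhm) fun v => (hparts v).2
  filter_upwards [hre, him] with ω h1 h2
  simp only [Pi.zero_apply] at h1 h2 ⊢
  exact Complex.ext h1 h2

end ComplexCase

end Literature.Probability.Process
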